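import Mathlib.Analysis.Asymptotics.AsymptoticEquivalent
import Literature.NumberTheory.Sieve.ParityBarrier
import HarnessLib

/-!
# Barrier catalogue `Parity`: Ford's fixed-level barrier for Bombieri's asymptotic sieve

Catalogue entry (D-0021) for the summit `Parity`. Bombieri's asymptotic sieve
(`Literature.NumberTheory.Sieve.bombieri_asymptotic_sieve` in `Literature/NumberTheory/Sieve/ParityBarrier.lean`) deduces
`∑_{n ≤ x} a_n Λ_k(n) ∼ k H A(x) (log x)^{k−1}` for every `k ≥ 2` from Type-I data of level
`x^{1−ε}` for EVERY `ε > 0`. Ford (2005) proved that this hypothesis cannot be relaxed to any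
FIXED level `x^ν`, `ν < 1`: there are non-negative sequences with `A(x) = x`, `g(d) = 1/d`
satisfying `R(ν)` for which the `Λ_k`-asymptotic fails for every `k ≥ 1`.

* `FordFixedLevelBarrier` — Ford's Theorem 1 (first assertion), a named fact, with the
  structured barrier block in its docstring. `Λ_k` is the tree's `Literature.NumberTheory.Sieve.generalizedVonMangoldt`.
  It is a THEOREM of the tree: `FordFixedLevelBarrier_holds` (`FordFixedLevelProofs.lean`, from
  Ford's local construction `Literature.NumberTheory.Sieve.Ford2004_localConstruction_holds` and the
  prime number theorem with the de la Vallée Poussin error term; axioms `propext`,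
  `Classical.choice`, `Quot.sound`). The printed construction delivers more than this statement
  records — `0 ≤ a_n ≤ 2` ((2.3)) and the POINTWISE bound `A_d(x) = x/d + O((x/d)e^{−(c₁/2)√log x})`
  for every `d ≤ x^ν` (§2, p. 5) — and that surplus is what makes the barrier bite on fixed-level
  variants of Bombieri's theorem carrying crude size hypotheses or the `sup_{y ≤ x}` form of the
  level hypothesis; it is kept in the companion theorem `fordFixedLevel_pointwise`
  (`FordFixedLevelPointwise.lean`, barrier audit 2026-08-16).

## References (read at the cited pages)

* K. Ford, *On Bombieri's asymptotic sieve*, Trans. AMS 357 (2005), 1663–1674 (arXiv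
  math/0401215), §1 and Theorem 1.
* J. B. Friedlander, *Producing prime numbers via sieve methods*, LNM 1891 (2006), §1,
  "Bombieri's Sieve" (last paragraph: optimality of Bombieri's theorem, after Ford).
* E. Bombieri, *The asymptotic sieve*, Rend. Accad. Naz. XL (5) 1/2 (1975/76), 243–269.
* J. Friedlander, H. Iwaniec, *On Bombieri's asymptotic sieve*, Ann. Scuola Norm. Sup. Pisa (4) 5
  (1978), 719–756, Theorem 2 and Corollary (pp. 722–723), §4 (pp. 738–740).
* O. Ramaré, *On Bombieri's asymptotic sieve*, J. Number Theory 130 (2010), 1155–1189, §1.1–1.3,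
  Theorems 1–2 (read, HAL hal-02572790 pp. 2–5).
-/

noncomputable section

open Filter Asymptotics Finset

namespace Literature.Barriers.Parity

/-- **Ford's fixed-level barrier** (sharpness of Bombieri's asymptotic sieve). Write
`A_d(x) = ∑_{n ≤ x, d ∣ n} a_n`, `R(ν)`: `∀ B > 0, ∑_{d ≤ x^ν} |A_d(x) − x/d| ≪_{ν,B} x (log x)^{−B}`
(Type-I data `A(x) = x`, `g(d) = 1/d`, so `H = 1`), and `(S_k)`:
`∑_{n ≤ x} a_n Λ_k(n) ∼ k x (log x)^{k−1}`, `Λ_k = μ ⋆ log^k` (`Literature.NumberTheory.Sieve.generalizedVonMangoldt`).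
Theorem (Ford): for every fixed `ν ∈ (0, 1)` there is a sequence `(a_n)` of non-negative reals
satisfying `R(ν)` for which `(S_k)` fails for EVERY `k ≥ 1`. (Ford moreover prescribes the
failure: `S_k(x)/(k x (log x)^{k−1}) → ξ_k` with all `ξ_k < 1`, or all `ξ_k > 1`, or
oscillating about `1` for every `k`; and `a_n ∈ {0, 1, 2}` can be arranged. Only the first
assertion is transcribed here; the bound `0 ≤ a_n ≤ 2` ((2.3)) and the pointwise remainder bound
of §2, p. 5 are kept in the companion theorem `fordFixedLevel_pointwise`.) PROVED in the tree:
`FordFixedLevelBarrier_holds`. [cite: Ford2004, Theorem 1] [cite: Friedlander2006ProducingPrimes, §1 Bombieri's Sieve]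

BARRIER (D-0021; one line per key):
technique_class: sieve type-I level-of-distribution bombieri-vinogradov asymptotic-sieve almost-primes
blocks: deducing an EXACT ASYMPTOTIC `∑_{n ≤ x} a_n Λ_k(n) ∼ k H A(x)(log x)^{k−1}` for a FIXED `k ≥ 1` (primes `k = 1`, Bombieri's almost-prime weights `k ≥ 2`) from Type-I data of a FIXED level `x^ν`, `ν < 1` — whether in the `ℓ¹` form `R(ν)`, pointwise for every `d ≤ x^ν`, or in Bombieri's `sup_{y ≤ x}` form (A₂) at an exponent `θ₀ < 1` — together with any of the crude size hypotheses of the asymptotic sieve (`0 ≤ a_n ≤ 2` is attained, hence second-moment bounds, divisor-boundedness and Bombieri's individual bound (A₃) for all `d < x`), and nothing else; e.g. from Bombieri–Vinogradov-type input (`ν < 1/2`) or from any single level `x^{1−δ}`, `δ > 0` fixed: Bombieri's theorem (`Literature.NumberTheory.Sieve.bombieri_asymptotic_sieve`, `Literature.NumberTheory.Sieve.Bombieri1976_asymptotic_sieve`) genuinely needs level `x^{1−ε}` for every `ε > 0`, and its fixed-level variants (one `θ < 1` in place of `∀ θ < 1`, or `BombieriA2At θ₀`, `θ₀ < 1`,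 in place of (A₂)) are refutable from `fordFixedLevel_pointwise` (witness density `1/d`, `H = 1`) [cite: Ford2004, Theorem 1; §2 (2.3) and p. 5].
because: for each fixed `ν ∈ (0,1)` Ford constructs ONE non-negative sequence with `a_n ∈ [0, 2]` ((2.3); `{0,1,2}`-valued after a modification) having the Type-I data of the integers pointwise up to level `x^ν` — `A_d(x) = x/d + O((x/d) e^{−(c₁/2)√log x})` for every `d ≤ x^ν` (§2, p. 5), whence `R(ν)` — whose `Λ_k`-mass is asymptotically `ξ_k = 1 + σ θ_k/k` times the expected `k x (log x)^{k−1}`, `θ_k > 0`, for every `k ≥ 1` simultaneously (`σ = −1`: all `ξ_k < 1`; `σ = +1`: all `ξ_k > 1`; signs alternating on the blocks `2^{2^r} < x_j ≤ 2^{2^{r+1}}`: oscillation) [cite: Ford2004, Theorem 1, §2 (2.3)–(2.5) and p. 5]; the mass is moved among products `p_1⋯p_M` of primes `p_i > x^{1/M−δ}` on short intervals `(x_j, x_j(1 + e^{−c₁√log x_j})]` by smooth symmetric functions of `(log p_i/log n)` solving the linear system (3.3) that leaves every `A_d`, `d ≤ x^{1−ϖ}`, unchanged (Theorem 3; `M >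 1/(1−ν)` forced by (2.1)), the prime number theorem with the de la Vallée Poussin remainder being the only analytic input (Lemma 2.1) — "these examples become increasingly delicate as `ϑ` approaches `1`" [cite: Ford2004, §3 Theorem 3] [cite: Friedlander2006ProducingPrimes, §1 Bombieri's Sieve].
evasions_known: (a) level `x^{1−ε}` for EVERY `ε > 0` gives `(S_k)` for all `k ≥ 2` (Bombieri; tree `Literature.NumberTheory.Sieve.bombieri_asymptotic_sieve`, PROVED `Literature.NumberTheory.Sieve.Bombieri1976_asymptotic_sieve_holds`) [cite: BombieriAsymptoticSieve1976] [cite: Friedlander2006ProducingPrimes, §1 Theorem (Bombieri)]; (b) NEAR-asymptotics at a fixed level: for each `k ≥ 2` and `ε' > 0` some fixed level `x^{θ₀}`, `θ₀ = θ₀(k, ε', 𝒜) < 1`, already gives `|S_k(x) − kHA(x)(log x)^{k−1}| ≤ ε' kHA(x)(log x)^{k−1}` for all large `x` (Friedlander–Iwaniec's proof of Bombieri's theorem: level `x^{1−ε}` costs a relative error `O(ε^{1/3})`; tree `Literature.NumberTheory.Sieve.Bombieri1976_asymptotic_sieve_finiteLevel`, PROVED `…_holds`) — the barrier bites on the limit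 `ε' → 0` only, i.e. on EXACT asymptotics [cite: FriedlanderIwaniecPisa1978, §4 pp. 739-740]; in the same vein Ramaré, for the weights `Λ^{(2ν)} + Λ^{(ν)} ⋆ Λ^{(ν)}` at level `X^{1−δ}`: the main term of a model sequence `f₀` up to a relative error essentially `(ν²δ log(1/δ))^ν` [cite: Ramare2010, §1.2-1.3 Theorems 1-2], and, for the twin-prime sequence, Bombieri's `1 − c_k ≤ T_k(x) ≤ 1 + c_k`, `c_k → 0`, from `ν < 1/2` (using also Brun–Titchmarsh-type individual bounds, (A₃) for all `d ≤ x`) [cite: Ford2004, §1] [cite: FriedlanderIwaniecPisa1978, p. 723 Remark I.2]; (c) GROWING rank: at any fixed level `x^θ`, `0 < θ < θ₀ ≤ 1`, under (A₁)–(A₆), `∑_{n ≤ X} a_n Λ_k(n) ∼ kHA(X)(log X)^{k−1}` as `k = k(X) → ∞` with `k < c log log X/log log log X` (Friedlander–Iwaniec, Theorem 2 and Corollary; the tree transcribes the case `θ₀ = 1`, `Literature.NumberTheory.Sieve.FriedlanderIwaniec1978_corollary_scalar`) — Ford's theorem concerns each FIXED `k` (and his `ξ_k → 1` as `k → ∞`)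 [cite: FriedlanderIwaniecPisa1978, p. 722 Theorem 2, p. 723 Corollary]; (d) adding bilinear (Type-II) information — Friedlander–Iwaniec's `(R)` at some level `> 2/3` plus the bilinear condition `(B)` — yields even `S₁(x) ∼ H A(x)` [cite: Ford2004, §1] [cite: FriedlanderIwaniecASP1998].
scope_caveats: (i) EXACTNESS only: the theorem defeats the limit statement `(S_k)`; two-sided bounds, near-asymptotics with any prescribed relative error, and growing-rank asymptotics at fixed level all survive (evasions (b), (c)) [cite: FriedlanderIwaniecPisa1978, §4 and p. 723]; (ii) the deviation is positive but NOT quantified in print and is minute: `|ξ_k − 1| = θ_k/k`, `θ_k = ∫_{U_M} u_1^k ℓ(u − M^{−1}𝟙; δ)/(u_1⋯u_M)` with a bump of radius `δ ≤ (2M)^{−M}` (Theorem 3) in dimension `M − 1`, `M > 1/(1−ν)` ((2.1)) — at most about `(2M)^{−M²(1+o(1))}`, super-exponentially small in `1/(1−ν)` (the tree's product-tent variant of `f_{1_M}`: `e^{−O(M log M)}`); the true width of the fixed-level indeterminacy band for `Λ_k`, `k ≥ 2` — between this and the `O(ε^{1/3})` / `δ log(1/δ)`-type upper bounds of evasion (b)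 — is OPEN [cite: Ford2004, §3 Theorem 3 and proof of Theorem 1] [cite: Ramare2010, §1.3]; (iii) SAVINGS: `R(ν)` saves arbitrary powers of `log x`, and the construction's remainders are `O((x/d)e^{−(c₁/2)√log x})`, the de la Vallée Poussin remainder (Lemma 2.1) on intervals of relative length `e^{−c₁√log x}` ((2.2)); a fixed-level hypothesis with POWER saving `x^{−η}`, or Type-I control on intervals shorter than `x e^{−c√log x}`, is not covered by the printed theorem (no evasion through such hypotheses is known either) [cite: Ford2004, §2 (2.2), (2.4), Lemma 2.1 and p. 5]; (iv) DENSITY and CLASSES: printed and formalised for `(A(x), g) = (x, 1/d)`, `H = 1`, only — for another dimension-1 density (e.g. `1/φ(d)` on odd `d`, the shifted primes of `Literature.NumberTheory.Sieve.shiftedPrimes_hasLevelOfDistribution`) a transfer of the construction is routine but not in print — and only the homogeneous classes `d ∣ n` (the sieve's `A_d`) are controlled, nothing being asserted about `n ≡ a (mod d)`, `a ≠ 0` [cite: Ford2004, Theorem 1]; (v) PARITY BIAS: Ford's Theorem-1 sequences all exhibit a "global parity bias" (`P(x) = ∑_{n ≤ x} a_n μ(n)` large infinitely often): whether for each `ν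 < 1` there are sequences with `R(ν)` AND `P(x) ≪_B x (log x)^{−B}` failing `(S_k)` "we cannot as yet answer entirely" — Theorem 2 gives such sequences failing `(S_k)` for all `k ≥ 2`, but they satisfy `(S_1)`; Hooley's averaged condition `∑_{d ≤ x^α} |∑_{n ≤ x, d ∣ n} μ(n) a_n| ≪_B x (log x)^{−B}` is met by the Theorem-1 sequences only for `α < 1 − ν`, and "the case `α + ν > 1` remains open" [cite: Ford2004, §1 (Theorem 2 and the discussion around it)]; (vi) the statement is existential over purpose-built sequences (`a_n ∈ {0, 1, 2}` attainable) and asserts nothing about a specific arithmetic sequence such as the values of a polynomial or the shifted primes [cite: Ford2004, Theorem 1]; (vii) `FordFixedLevelBarrier` transcribes only the first assertion of Theorem 1 — not the failure modes (i)–(iii), not (2.3), not the pointwise bound (the last two: `fordFixedLevel_pointwise`, `FordFixedLevelPointwise.lean`).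
status: established (PROVED in the tree: `FordFixedLevelBarrier_holds`; barrier audit 2026-08-16: confirmed, scope lines sharpened) -/
def FordFixedLevelBarrier : Prop :=
  ∀ ν : ℝ, 0 < ν → ν < 1 →
    ∃ a : ℕ → ℝ, (∀ n, 0 ≤ a n) ∧
      (∀ B : ℝ, 0 < B →
        (fun x : ℝ => ∑ d ∈ Icc 1 ⌊x ^ ν⌋₊,
            |(∑ n ∈ (Ioc 0 ⌊x⌋₊).filter (d ∣ ·), a n) - x / d|) =O[atTop]
          fun x : ℝ => x / Real.log x ^ B) ∧
      ∀ k : ℕ, 1 ≤ k →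
        ¬ ((fun x : ℝ => ∑ n ∈ Ioc 0 ⌊x⌋₊, a n * Literature.NumberTheory.Sieve.generalizedVonMangoldt k n) ~[atTop]
            fun x : ℝ => (k : ℝ) * x * Real.log x ^ (k - 1))

end Literature.Barriers.Parity
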